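import Summits.Ventures.CertifiedManyBodySolver.Downfold.TPrimePinnedPairRowKernelBox
import Summits.Ventures.CertifiedManyBodySolver.Downfold.TPrimePinnedPairRowKernelChainQuotAdjNearGX
import HarnessLib

/-!
# The PINNED t′-PAIR shape ON THE BOX GEOMETRY OF RECORD for the «(N)-BY-ROWS» Gram input shapes with KERNEL-COMPUTED eom masks:
# `SquareTTPrimePinnedPairRowT.of_quotAdjChainNearKernelCertsGXAuto_box` (abstract Gram with anti-Hermitian remainder),
# `…of_quotAdjChainKernelCertsTBRowsHalfAuto_box` (`TGs_v := gramTBRowsHalf K_v blocks_v`, products ÷2) and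
# `…of_quotAdjChainKernelCertsTBRowsAuto_box` (`TGs_v := gramTBRows K_v blocks_v`, full rows);
# cell `pub/hubbard-obs` × `pub/hubbard-downfold`, D-0154 (1)(C) COVERAGE La214; seat `hubbard-cov-la214-unc-2`, lineage desk; zero compute

HONEST FRAMING: Lean plumbing towards «tier P» for PAIR claim nodes‴. hubbard-obs-p2's measured spine fact (S1/S2, `Rows/CARPolyWindowGramTBRows.lean`
p684213) makes the Gram part of every chain ONE SLICE PER BLOCK ROW (`gramTBRows`) and, with the exporter's adjoint-pair halving, ONE HALF ROW
(`gramTBRowsHalf`, denoting `G − V + Vᴴ` with `V := lowerTB`); the eom input of record is `autoMasks` (`Rows/CorrWindowCertKernelEomAuto.lean`,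
p683122). This file is the T-pair BOX EDITION of those input shapes on `BoxGeom.boxQuot r R vmax` (`Λ := boxW r ⊆ Λ' := boxW R`, letters `boxD R` /
`boxD r`, origin letters `orb (boxIx R 0) σ`), every table / letter / window hypothesis discharged in `(r, R, vmax)` under `7 ≤ R`, `r + 1 ≤ R`,
`r + vmax ≤ R` exactly as in `SquareTTPrimePinnedPairRowT.of_quotAdjChainNearKernelCertsG_box` (p682106 §3): (§1) `…GXAuto_box` — per vertex the
chain's Gram slices `TGs_v`, a named full list `TGf_v` with `termOp (boxD R) TGf_v = gramForm Λm_v O_v`, `Λm_v ⪰ 0`, and a remainder `V_v` with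
`termOp (boxD R) TGs_v.flatten = termOp (boxD R) TGf_v − termOp (boxD R) V_v + (termOp (boxD R) V_v)ᴴ`; (§2) **`…TBRowsHalfAuto_box`** —
`TGs_v := gramTBRowsHalf K_v blocks_v` with PSD-ness (`gramTBCoef_posSemidef`), the remainder identity (`termOp_flatten_gramTBRowsHalf`) and the
masks ALL discharged: per vertex the instance supplies `TH hH TE hE TX hX μ ν κ cap κ' fl K blocks CW hcw AV ns M Cs hC0 Hs hchain hβ` — table facts,
chain facts, ONE inequality; (§3) `…TBRowsAuto_box` — `TGs_v := gramTBRows K_v blocks_v` (full rows; `termOp_flatten_gramTBRows`) through p682106 §3.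
Nothing is asserted: no `def`, no named fact, no `sorry`, no number; no chain of record exists (nothing evaluated); CONTROL / CALIBRATION wording
class (xx1); no summit statement is proved by this file.

References: X. Han, arXiv:2006.06002 §2 eq. (2), §3 [Han2020Bootstrap]; S. Friedli, Y. Velenik, *Statistical Mechanics of Lattice Systems* §3.2
[FriedliVelenikSMLS2017]; J. Wang et al., PRX 14 (2024) 031006 §III [WangEtAl2024]; C. Jansson, D. Chaykin, C. Keil, SIAM J. Numer. Anal. 46
(2008) 180 [JanssonChaykinKeil2008]; O. Bratteli, D. W. Robinson, *Operator Algebras and Quantum Statistical Mechanics 2* §5.2.2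
[BratteliRobinsonII1997].
-/

noncomputable section

namespace Summit.Ventures.CertifiedManyBodySolver.Downfold

open Literature.MathematicalPhysics.QuantumLattice
open Matrix HubbardWave0 Literature.Probability.LatticeModels ThermodynamicLimit Filter Topology
open Literature.MathematicalPhysics.QuantumManyBody.StateRelaxation
open Summit.Ventures.CertifiedQuantumChemistry Summit.Ventures.CertifiedQuantumChemistry.CARPoly
open Summit.Ventures.CertifiedManyBodySolver.CARPolyWindow Summit.Ventures.CertifiedManyBodySolver.CARPolyWindow.BoxGeom
open Summit.Ventures.CertifiedManyBodySolver.Observables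
open scoped BigOperators ComplexOrder

/-! ## §1 THE BOX EDITION, abstract Gram with an anti-Hermitian remainder, kernel-computed eom masks -/

section KernelPairBoxGX

/-- **KERNEL FORM OF THE PAIR NODE‴ ON THE BOX GEOMETRY OF RECORD — «ROWS + HALVING» INPUT SHAPE, ABSTRACT GRAM, AUTO MASKS**:
`D := boxQuot r R vmax`, `Λ := boxW r ⊆ Λ' := boxW R`, letters `boxD R` / `boxD r`, origin letters `orb (boxIx R 0) σ`; all geometry hypotheses of
`SquareTTPrimePinnedPairRowT.of_quotAdjChainNearKernelCertsGXAuto_wide` discharged under `7 ≤ R`, `r + 1 ≤ R`, `r + vmax ≤ R`. Per vertex the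
instance supplies `TH hH TE hE TX hX μ ν κ cap κ' fl`, the chain's Gram slices `TGs`, a named full list `TGf` with `hTGf` and `Λm ⪰ 0`, the
remainder `V` with `hG`, `CW hcw AV`, the `stepEQA` chain `ns M Cs hC0 Hs hchain` over `residTGslicesNear … TGs TH (boxPush r R) EB
(autoMasks TH (boxPush r R) EB) …`, and the price `hβ`. [cite: WangEtAl2024, §III] [cite: Han2020Bootstrap, §3] [cite: JanssonChaykinKeil2008, §3] -/
theorem SquareTTPrimePinnedPairRowT.of_quotAdjChainNearKernelCertsGXAuto_box
    (r R vmax : ℕ) (h7R : 7 ≤ R) (hrR : r + 1 ≤ R) (hvR : r + vmax ≤ R)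
    (U : ℚ) (hU : 0 ≤ U) (n₀ : ℚ) (hn0 : 0 ≤ n₀) (hn2 : n₀ < 2) (sA sB : ℚ) (Bkey : ℕ)
    -- the objective family and the SHARED eom words (inner letters)
    (X : ℝ → FermionOp (box 2 7)) (EB : List (Terms (Orb (Fin (boxN r)))))
    -- vertex A
    (THA : Terms (Orb (Fin (boxN R))))
    (hHA : termOp (boxD R) THA = (hubbardTTPrimeFermionInteraction 1 (sA : ℝ) (U : ℝ)).localHamiltonian (boxW R))
    (TEA : Terms (Orb (Fin (boxN R))))
    (hEA : termOp (boxD R) TEA =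
      fermionEmbed (PolySite.incl (thicken01_subset_boxW (le_trans (by norm_num) h7R)))
        ((hubbardTTPrimeFermionInteraction 1 (sA : ℝ) (U : ℝ)).meanEnergyObs 1))
    (TXA : Terms (Orb (Fin (boxN R)))) (hXA : termOp (boxD R) TXA = fermionEmbed (PolySite.incl (box_subset_boxW h7R)) (X (sA : ℝ)))
    (μA : Fin 2 → ℚ) (νA κA capA κA' flA : ℚ)
    (TGsA : List (Terms (Orb (Fin (boxN R))))) (TGfA VA : Terms (Orb (Fin (boxN R))))
    {mA : Type*} [Fintype mA] [DecidableEq mA] {ΛmA : Matrix mA mA ℂ} (hΛmA : ΛmA.PosSemidef)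
    (OA : mA → FermionOp (boxW R)) (hTGfA : termOp (boxD R) TGfA = gramForm ΛmA OA)
    (hGA : termOp (boxD R) TGsA.flatten = termOp (boxD R) TGfA - termOp (boxD R) VA + (termOp (boxD R) VA)ᴴ)
    (CWA : Terms (Orb (Fin (boxN R)))) (hcwA : ∀ wc ∈ CWA, chargeW wc.1 ≠ 0 ∨ spinChargeW (fun a => (ofLex a).2) wc.1 ≠ 0)
    (AVA : List (Terms (Orb (Fin (boxN R)))))
    (nsA : List ℕ) (MA : ℕ) (CsA : List SOSDual.EncPoly) (hC0A : CsA.getD 0 [] = []) (HsA : List (List (QHint (boxN r))))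
    (hchainA : ChainQAOK (boxQuot r R vmax) Bkey MA CsA
      (groupSlices (residTGslicesNear TXA μA νA (fun σ => orb (boxIx R 0) σ) κA capA κA' flA TEA TGsA THA (boxPush r R) EB
        (autoMasks THA (boxPush r R) EB) (fun l : Fin 0 => l.elim0) (fun l : Fin 0 => l.elim0) CWA AVA) nsA) HsA)
    {βA : ℚ}
    (hβA : haveI := neZero_boxN R; βA ≤ lowerConst (SOSDual.decPoly (boxN R) (CsA.getD MA [])) + (μA 0 + μA 1) * (n₀ / 2 - νA))
    -- vertex B
    (THB : Terms (Orb (Fin (boxN R))))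
    (hHB : termOp (boxD R) THB = (hubbardTTPrimeFermionInteraction 1 (sB : ℝ) (U : ℝ)).localHamiltonian (boxW R))
    (TEB : Terms (Orb (Fin (boxN R))))
    (hEB : termOp (boxD R) TEB =
      fermionEmbed (PolySite.incl (thicken01_subset_boxW (le_trans (by norm_num) h7R)))
        ((hubbardTTPrimeFermionInteraction 1 (sB : ℝ) (U : ℝ)).meanEnergyObs 1))
    (TXB : Terms (Orb (Fin (boxN R)))) (hXB : termOp (boxD R) TXB = fermionEmbed (PolySite.incl (box_subset_boxW h7R)) (X (sB : ℝ)))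
    (μB : Fin 2 → ℚ) (νB κB capB κB' flB : ℚ)
    (TGsB : List (Terms (Orb (Fin (boxN R))))) (TGfB VB : Terms (Orb (Fin (boxN R))))
    {mB : Type*} [Fintype mB] [DecidableEq mB] {ΛmB : Matrix mB mB ℂ} (hΛmB : ΛmB.PosSemidef)
    (OB : mB → FermionOp (boxW R)) (hTGfB : termOp (boxD R) TGfB = gramForm ΛmB OB)
    (hGB : termOp (boxD R) TGsB.flatten = termOp (boxD R) TGfB - termOp (boxD R) VB + (termOp (boxD R) VB)ᴴ)
    (CWB : Terms (Orb (Fin (boxN R)))) (hcwB : ∀ wc ∈ CWB, chargeW wc.1 ≠ 0 ∨ spinChargeW (fun a => (ofLex a).2) wc.1 ≠ 0)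
    (AVB : List (Terms (Orb (Fin (boxN R)))))
    (nsB : List ℕ) (MB : ℕ) (CsB : List SOSDual.EncPoly) (hC0B : CsB.getD 0 [] = []) (HsB : List (List (QHint (boxN r))))
    (hchainB : ChainQAOK (boxQuot r R vmax) Bkey MB CsB
      (groupSlices (residTGslicesNear TXB μB νB (fun σ => orb (boxIx R 0) σ) κB capB κB' flB TEB TGsB THB (boxPush r R) EB
        (autoMasks THB (boxPush r R) EB) (fun l : Fin 0 => l.elim0) (fun l : Fin 0 => l.elim0) CWB AVB) nsB) HsB)
    {βB : ℚ}
    (hβB : haveI := neZero_boxN R; βB ≤ lowerConst (SOSDual.decPoly (boxN R) (CsB.getD MB [])) + (μB 0 + μB 1) * (n₀ / 2 - νB))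
    : SquareTTPrimePinnedPairRowT (U : ℝ) (n₀ : ℝ) (sA : ℝ) (sB : ℝ) capA capB flA flB βA κA κA' βB κB κB' X := by
  haveI : NeZero (boxN R) := neZero_boxN R
  have hrR' : r ≤ R := by omega
  exact SquareTTPrimePinnedPairRowT.of_quotAdjChainNearKernelCertsGXAuto_wide U hU n₀ hn0 hn2 sA sB (box_subset_boxW h7R) (boxW_mono hrR')
    (thicken_boxW_subset_boxW hrR) (thicken01_subset_boxW (le_trans (by norm_num) h7R)) (zero_mem_boxW R)
    (boxQuot r R vmax) (boxXs_mem R) (fun y hy => boxXs_boxIx R y hy) (boxXs_mem r) (boxQuot_hcovβ r R vmax)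
    (boxD R) (boxD_injective R) (boxD_orb R) Bkey (boxD r) (boxQuot_hdΛ r R vmax) (fun b => boxD_boxPush hrR' b)
    (fun a => (ofLex a).2) (boxD_spin R) (fun γc v hok j => box_hokV hvR γc v hok j) (fun σ => orb (boxIx R 0) σ) (boxD_orb_boxIx_zero R) X EB
    THA hHA TEA hEA TXA hXA μA νA κA capA κA' flA TGsA TGfA VA hΛmA OA hTGfA hGA CWA hcwA AVA nsA MA CsA hC0A HsA hchainA hβA
    THB hHB TEB hEB TXB hXB μB νB κB capB κB' flB TGsB TGfB VB hΛmB OB hTGfB hGB CWB hcwB AVB nsB MB CsB hC0B HsB hchainB hβB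

end KernelPairBoxGX

/-! ## §2 THE BOX EDITION, two-level Gram by HALF ROWS (`TGs_v := gramTBRowsHalf K_v blocks_v`), kernel-computed eom masks -/

section KernelPairBoxRowsHalf

/-- **KERNEL FORM OF THE PAIR NODE‴ ON THE BOX GEOMETRY OF RECORD — TWO-LEVEL GRAM BY HALF ROWS, AUTO MASKS** (the design of record of
captain R-g4-4 rev 9f for the W3 T-pair instances): `TGs_v := gramTBRowsHalf K_v blocks_v` (products ÷2); PSD-ness, the anti-Hermitian remainder
`lowerTB K_v blocks_v` and the eom masks are discharged here. Per vertex the instance supplies `TH hH TE hE TX hX μ ν κ cap κ' fl K blocks CW hcw AV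
ns M Cs hC0 Hs hchain hβ` — table facts, the chain facts, ONE inequality. [cite: WangEtAl2024, §III] [cite: Han2020Bootstrap, §2 eq. (2)]
[cite: JanssonChaykinKeil2008, §3] -/
theorem SquareTTPrimePinnedPairRowT.of_quotAdjChainKernelCertsTBRowsHalfAuto_box
    (r R vmax : ℕ) (h7R : 7 ≤ R) (hrR : r + 1 ≤ R) (hvR : r + vmax ≤ R)
    (U : ℚ) (hU : 0 ≤ U) (n₀ : ℚ) (hn0 : 0 ≤ n₀) (hn2 : n₀ < 2) (sA sB : ℚ) (Bkey : ℕ)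
    -- the objective family and the SHARED eom words (inner letters)
    (X : ℝ → FermionOp (box 2 7)) (EB : List (Terms (Orb (Fin (boxN r)))))
    -- vertex A
    (THA : Terms (Orb (Fin (boxN R))))
    (hHA : termOp (boxD R) THA = (hubbardTTPrimeFermionInteraction 1 (sA : ℝ) (U : ℝ)).localHamiltonian (boxW R))
    (TEA : Terms (Orb (Fin (boxN R))))
    (hEA : termOp (boxD R) TEA =
      fermionEmbed (PolySite.incl (thicken01_subset_boxW (le_trans (by norm_num) h7R)))
        ((hubbardTTPrimeFermionInteraction 1 (sA : ℝ) (U : ℝ)).meanEnergyObs 1))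
    (TXA : Terms (Orb (Fin (boxN R)))) (hXA : termOp (boxD R) TXA = fermionEmbed (PolySite.incl (box_subset_boxW h7R)) (X (sA : ℝ)))
    (μA : Fin 2 → ℚ) (νA κA capA κA' flA : ℚ)
    (KA : ℕ) (blocksA : List (List (List ℤ × Terms (Orb (Fin (boxN R))))))
    (CWA : Terms (Orb (Fin (boxN R)))) (hcwA : ∀ wc ∈ CWA, chargeW wc.1 ≠ 0 ∨ spinChargeW (fun a => (ofLex a).2) wc.1 ≠ 0)
    (AVA : List (Terms (Orb (Fin (boxN R)))))
    (nsA : List ℕ) (MA : ℕ) (CsA : List SOSDual.EncPoly) (hC0A : CsA.getD 0 [] = []) (HsA : List (List (QHint (boxN r))))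
    (hchainA : ChainQAOK (boxQuot r R vmax) Bkey MA CsA
      (groupSlices (residTGslicesNear TXA μA νA (fun σ => orb (boxIx R 0) σ) κA capA κA' flA TEA (gramTBRowsHalf KA blocksA) THA
        (boxPush r R) EB (autoMasks THA (boxPush r R) EB) (fun l : Fin 0 => l.elim0) (fun l : Fin 0 => l.elim0) CWA AVA) nsA) HsA)
    {βA : ℚ}
    (hβA : haveI := neZero_boxN R; βA ≤ lowerConst (SOSDual.decPoly (boxN R) (CsA.getD MA [])) + (μA 0 + μA 1) * (n₀ / 2 - νA))
    -- vertex B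
    (THB : Terms (Orb (Fin (boxN R))))
    (hHB : termOp (boxD R) THB = (hubbardTTPrimeFermionInteraction 1 (sB : ℝ) (U : ℝ)).localHamiltonian (boxW R))
    (TEB : Terms (Orb (Fin (boxN R))))
    (hEB : termOp (boxD R) TEB =
      fermionEmbed (PolySite.incl (thicken01_subset_boxW (le_trans (by norm_num) h7R)))
        ((hubbardTTPrimeFermionInteraction 1 (sB : ℝ) (U : ℝ)).meanEnergyObs 1))
    (TXB : Terms (Orb (Fin (boxN R)))) (hXB : termOp (boxD R) TXB = fermionEmbed (PolySite.incl (box_subset_boxW h7R)) (X (sB : ℝ)))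
    (μB : Fin 2 → ℚ) (νB κB capB κB' flB : ℚ)
    (KB : ℕ) (blocksB : List (List (List ℤ × Terms (Orb (Fin (boxN R))))))
    (CWB : Terms (Orb (Fin (boxN R)))) (hcwB : ∀ wc ∈ CWB, chargeW wc.1 ≠ 0 ∨ spinChargeW (fun a => (ofLex a).2) wc.1 ≠ 0)
    (AVB : List (Terms (Orb (Fin (boxN R)))))
    (nsB : List ℕ) (MB : ℕ) (CsB : List SOSDual.EncPoly) (hC0B : CsB.getD 0 [] = []) (HsB : List (List (QHint (boxN r))))
    (hchainB : ChainQAOK (boxQuot r R vmax) Bkey MB CsB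
      (groupSlices (residTGslicesNear TXB μB νB (fun σ => orb (boxIx R 0) σ) κB capB κB' flB TEB (gramTBRowsHalf KB blocksB) THB
        (boxPush r R) EB (autoMasks THB (boxPush r R) EB) (fun l : Fin 0 => l.elim0) (fun l : Fin 0 => l.elim0) CWB AVB) nsB) HsB)
    {βB : ℚ}
    (hβB : haveI := neZero_boxN R; βB ≤ lowerConst (SOSDual.decPoly (boxN R) (CsB.getD MB [])) + (μB 0 + μB 1) * (n₀ / 2 - νB))
    : SquareTTPrimePinnedPairRowT (U : ℝ) (n₀ : ℝ) (sA : ℝ) (sB : ℝ) capA capB flA flB βA κA κA' βB κB κB' X :=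
  SquareTTPrimePinnedPairRowT.of_quotAdjChainNearKernelCertsGXAuto_box r R vmax h7R hrR hvR U hU n₀ hn0 hn2 sA sB Bkey X EB
    THA hHA TEA hEA TXA hXA μA νA κA capA κA' flA (gramTBRowsHalf KA blocksA) (gramTB KA blocksA) (lowerTB KA blocksA)
    (gramTBCoef_posSemidef KA blocksA) (gramTBOp (boxD R) blocksA) (termOp_gramTB_eq_gramForm (boxD R) KA blocksA)
    (termOp_flatten_gramTBRowsHalf (boxD R) KA blocksA) CWA hcwA AVA nsA MA CsA hC0A HsA hchainA hβA
    THB hHB TEB hEB TXB hXB μB νB κB capB κB' flB (gramTBRowsHalf KB blocksB) (gramTB KB blocksB) (lowerTB KB blocksB)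
    (gramTBCoef_posSemidef KB blocksB) (gramTBOp (boxD R) blocksB) (termOp_gramTB_eq_gramForm (boxD R) KB blocksB)
    (termOp_flatten_gramTBRowsHalf (boxD R) KB blocksB) CWB hcwB AVB nsB MB CsB hC0B HsB hchainB hβB

end KernelPairBoxRowsHalf

/-! ## §3 THE BOX EDITION, two-level Gram by FULL ROWS (`TGs_v := gramTBRows K_v blocks_v`), kernel-computed eom masks -/

section KernelPairBoxRows

/-- **KERNEL FORM OF THE PAIR NODE‴ ON THE BOX GEOMETRY OF RECORD — TWO-LEVEL GRAM BY FULL ROWS, AUTO MASKS**: `TGs_v := gramTBRows K_v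
blocks_v` (one slice per block row, no halving); PSD-ness and the masks discharged here (`termOp_flatten_gramTBRows`, `gramTBCoef_posSemidef`,
`eomFarOK_autoMasks`) through `SquareTTPrimePinnedPairRowT.of_quotAdjChainNearKernelCertsG_box`. Per vertex the instance supplies `TH hH TE hE TX
hX μ ν κ cap κ' fl K blocks CW hcw AV ns M Cs hC0 Hs hchain hβ`. [cite: WangEtAl2024, §III] [cite: Han2020Bootstrap, §2 eq. (2)]
[cite: JanssonChaykinKeil2008, §3] -/
theorem SquareTTPrimePinnedPairRowT.of_quotAdjChainKernelCertsTBRowsAuto_box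
    (r R vmax : ℕ) (h7R : 7 ≤ R) (hrR : r + 1 ≤ R) (hvR : r + vmax ≤ R)
    (U : ℚ) (hU : 0 ≤ U) (n₀ : ℚ) (hn0 : 0 ≤ n₀) (hn2 : n₀ < 2) (sA sB : ℚ) (Bkey : ℕ)
    -- the objective family and the SHARED eom words (inner letters)
    (X : ℝ → FermionOp (box 2 7)) (EB : List (Terms (Orb (Fin (boxN r)))))
    -- vertex A
    (THA : Terms (Orb (Fin (boxN R))))
    (hHA : termOp (boxD R) THA = (hubbardTTPrimeFermionInteraction 1 (sA : ℝ) (U : ℝ)).localHamiltonian (boxW R))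
    (TEA : Terms (Orb (Fin (boxN R))))
    (hEA : termOp (boxD R) TEA =
      fermionEmbed (PolySite.incl (thicken01_subset_boxW (le_trans (by norm_num) h7R)))
        ((hubbardTTPrimeFermionInteraction 1 (sA : ℝ) (U : ℝ)).meanEnergyObs 1))
    (TXA : Terms (Orb (Fin (boxN R)))) (hXA : termOp (boxD R) TXA = fermionEmbed (PolySite.incl (box_subset_boxW h7R)) (X (sA : ℝ)))
    (μA : Fin 2 → ℚ) (νA κA capA κA' flA : ℚ)
    (KA : ℕ) (blocksA : List (List (List ℤ × Terms (Orb (Fin (boxN R))))))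
    (CWA : Terms (Orb (Fin (boxN R)))) (hcwA : ∀ wc ∈ CWA, chargeW wc.1 ≠ 0 ∨ spinChargeW (fun a => (ofLex a).2) wc.1 ≠ 0)
    (AVA : List (Terms (Orb (Fin (boxN R)))))
    (nsA : List ℕ) (MA : ℕ) (CsA : List SOSDual.EncPoly) (hC0A : CsA.getD 0 [] = []) (HsA : List (List (QHint (boxN r))))
    (hchainA : ChainQAOK (boxQuot r R vmax) Bkey MA CsA
      (groupSlices (residTGslicesNear TXA μA νA (fun σ => orb (boxIx R 0) σ) κA capA κA' flA TEA (gramTBRows KA blocksA) THA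
        (boxPush r R) EB (autoMasks THA (boxPush r R) EB) (fun l : Fin 0 => l.elim0) (fun l : Fin 0 => l.elim0) CWA AVA) nsA) HsA)
    {βA : ℚ}
    (hβA : haveI := neZero_boxN R; βA ≤ lowerConst (SOSDual.decPoly (boxN R) (CsA.getD MA [])) + (μA 0 + μA 1) * (n₀ / 2 - νA))
    -- vertex B
    (THB : Terms (Orb (Fin (boxN R))))
    (hHB : termOp (boxD R) THB = (hubbardTTPrimeFermionInteraction 1 (sB : ℝ) (U : ℝ)).localHamiltonian (boxW R))
    (TEB : Terms (Orb (Fin (boxN R))))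
    (hEB : termOp (boxD R) TEB =
      fermionEmbed (PolySite.incl (thicken01_subset_boxW (le_trans (by norm_num) h7R)))
        ((hubbardTTPrimeFermionInteraction 1 (sB : ℝ) (U : ℝ)).meanEnergyObs 1))
    (TXB : Terms (Orb (Fin (boxN R)))) (hXB : termOp (boxD R) TXB = fermionEmbed (PolySite.incl (box_subset_boxW h7R)) (X (sB : ℝ)))
    (μB : Fin 2 → ℚ) (νB κB capB κB' flB : ℚ)
    (KB : ℕ) (blocksB : List (List (List ℤ × Terms (Orb (Fin (boxN R))))))
    (CWB : Terms (Orb (Fin (boxN R)))) (hcwB : ∀ wc ∈ CWB, chargeW wc.1 ≠ 0 ∨ spinChargeW (fun a => (ofLex a).2) wc.1 ≠ 0)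
    (AVB : List (Terms (Orb (Fin (boxN R)))))
    (nsB : List ℕ) (MB : ℕ) (CsB : List SOSDual.EncPoly) (hC0B : CsB.getD 0 [] = []) (HsB : List (List (QHint (boxN r))))
    (hchainB : ChainQAOK (boxQuot r R vmax) Bkey MB CsB
      (groupSlices (residTGslicesNear TXB μB νB (fun σ => orb (boxIx R 0) σ) κB capB κB' flB TEB (gramTBRows KB blocksB) THB
        (boxPush r R) EB (autoMasks THB (boxPush r R) EB) (fun l : Fin 0 => l.elim0) (fun l : Fin 0 => l.elim0) CWB AVB) nsB) HsB)
    {βB : ℚ}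
    (hβB : haveI := neZero_boxN R; βB ≤ lowerConst (SOSDual.decPoly (boxN R) (CsB.getD MB [])) + (μB 0 + μB 1) * (n₀ / 2 - νB))
    : SquareTTPrimePinnedPairRowT (U : ℝ) (n₀ : ℝ) (sA : ℝ) (sB : ℝ) capA capB flA flB βA κA κA' βB κB κB' X :=
  SquareTTPrimePinnedPairRowT.of_quotAdjChainNearKernelCertsG_box r R vmax h7R hrR hvR U hU n₀ hn0 hn2 sA sB Bkey X EB
    THA hHA TEA hEA TXA hXA μA νA κA capA κA' flA (gramTBRows KA blocksA) (gramTBCoef_posSemidef KA blocksA) (gramTBOp (boxD R) blocksA)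
    (termOp_flatten_gramTBRows (boxD R) KA blocksA) (autoMasks THA (boxPush r R) EB) (eomFarOK_autoMasks THA (boxPush r R) EB)
    CWA hcwA AVA nsA MA CsA hC0A HsA hchainA hβA
    THB hHB TEB hEB TXB hXB μB νB κB capB κB' flB (gramTBRows KB blocksB) (gramTBCoef_posSemidef KB blocksB) (gramTBOp (boxD R) blocksB)
    (termOp_flatten_gramTBRows (boxD R) KB blocksB) (autoMasks THB (boxPush r R) EB) (eomFarOK_autoMasks THB (boxPush r R) EB)
    CWB hcwB AVB nsB MB CsB hC0B HsB hchainB hβB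

end KernelPairBoxRows

end Summit.Ventures.CertifiedManyBodySolver.Downfold

end
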